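import Mathlib.Analysis.SpecialFunctions.Log.Deriv
import Literature.Analysis.FluidPDE.CompressibleEulerImplosionProofs
import Literature.Analysis.FluidPDE.CompressibleEulerImplosionCoords
import HarnessLib

/-!
# Buckmaster–Cao-Labora–Gómez-Serrano at `γ = 5/3`: Theorem 1.1 reduced to the phase portrait of (1.8)

Topic `Literature/Analysis/FluidPDE`; namespace
`Literature.Analysis.FluidPDE.BuckmasterCaolaboraGomezserrano2025`. Companion of
`CompressibleEulerImplosion.lean` (named fact `BuckmasterCaolaboraGomezserrano2025_thm11_monatomic`,
THEOREM 1.1 of T. Buckmaster, G. Cao-Labora, J. Gómez-Serrano, *Smooth imploding solutions for 3D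
compressible fluids*, Forum Math. Pi 13 (2025) e6, arXiv:2208.09445, at `γ = 5/3`, `α = 1/3`);
sequel of `CompressibleEulerImplosionProofs.lean` (glue H: `thm11_monatomic_of_profile`) and of
`CompressibleEulerImplosionCoords.lean` (the dictionary `(W, Z, ξ) ↔ 𝒲(ζ)`, eq. (2.13)); the
analytic germ at `ζ = 0` required below is supplied by `CompressibleEulerImplosionOriginSeries.lean`
(Prop. 2.5: the origin series `Σ wᵢ ζⁱ`, `OriginSeries.analyticAt_profile`, `profile_zero`).

Brick G-glue of the discharge plan: the vendored Theorem 1.1 (`γ = 5/3`) follows from a purely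
dynamical statement about the autonomous system (1.8) — the existence, for some `r` in the window,
of a global smooth solution `(W, Z) : ℝ → ℝ²` of (1.8) (in the multiplied form
`D_W W′ = N_W`, `D_Z Z′ = N_Z`) with `Z < W`, `(W, Z) → P_∞ = (0,0)` as `ξ → +∞`, whose pull-back
profile `ζ ↦ ζ W(log ζ)`, `ζ ↦ ζ Z(log ζ)` on the two half-lines agrees, near `ζ = 0`, with a germ
analytic at `0` with positive value there — e.g. the origin power series of Proposition 2.5 (i.e.
the orbit emanates from `P₀`). This is exactly the shape in
which §6 ("Proof of Theorem 1.1") delivers the solution: the `P₀`-trajectory (Prop. 2.5), equal to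
the smooth `ν₋` branch through `P_s` for `r = r^{(3)}` (shooting, §§3–6), continued to `P_∞`
(Prop. 3.1). (`thm11_monatomic_of_WZ`; one real definition `profileOfWZ` with body.)
[cite: BuckmasterCaolaboraGomezserrano2025, Theorem 1.1, §1.3 eqs. (1.8)–(1.10), Prop. 2.5, Prop. 3.1, §6]
-/

noncomputable section

open Set Filter Topology
open scoped ContDiff

namespace Literature.Analysis.FluidPDE

namespace BuckmasterCaolaboraGomezserrano2025

/-- The self-similar profile `𝒲(ζ)` assembled from a solution `(W, Z)(ξ)` of (1.8) via
`ζ = e^ξ` (eq. (2.13)): `𝒲(ζ) = ζ W(log ζ)` for `ζ > 0`, `𝒲(ζ) = ζ Z(log(−ζ))` for `ζ < 0`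
(i.e. `𝒵(ζ) = −𝒲(−ζ)`), and `𝒲(0) = A = w₀`. [cite: BuckmasterCaolaboraGomezserrano2025, eq. (2.13), Prop. 2.5] -/
def profileOfWZ (W Z : ℝ → ℝ) (A : ℝ) (ζ : ℝ) : ℝ :=
  if 0 < ζ then ζ * W (Real.log ζ) else if ζ < 0 then ζ * Z (Real.log (-ζ)) else A

/-- [folklore] -/
theorem profileOfWZ_pos {W Z : ℝ → ℝ} {A ζ : ℝ} (hζ : 0 < ζ) :
    profileOfWZ W Z A ζ = ζ * W (Real.log ζ) := by
  simp [profileOfWZ, hζ]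

/-- [folklore] -/
theorem profileOfWZ_neg {W Z : ℝ → ℝ} {A ζ : ℝ} (hζ : ζ < 0) :
    profileOfWZ W Z A ζ = ζ * Z (Real.log (-ζ)) := by
  simp [profileOfWZ, hζ, not_lt.mpr hζ.le]

/-- [folklore] -/
theorem profileOfWZ_zero {W Z : ℝ → ℝ} {A : ℝ} : profileOfWZ W Z A 0 = A := by
  simp [profileOfWZ]

/-- **Theorem 1.1 at `γ = 5/3` from the phase portrait.** Let `r` lie in the window and let
`(W, Z) : ℝ → ℝ²` be a smooth global solution of (1.8) in the form `D_W W′ = N_W`, `D_Z Z′ = N_Z`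
with `Z < W` everywhere and `(W, Z)(ξ) → (0, 0)` as `ξ → +∞`, such that for some `ε > 0` the
profile pieces `ζ W(log ζ)` and `−ζ Z(log ζ)` coincide on `(0, ε)` with `g(ζ)`, `g(−ζ)` for a
germ `g` analytic at `0` with `g(0) > 0` (Proposition 2.5 provides `g = Σ wᵢ ζⁱ`, `g(0) = A`: the
orbit emanates from `P₀`). Then `BuckmasterCaolaboraGomezserrano2025_thm11_monatomic` holds.
[cite: BuckmasterCaolaboraGomezserrano2025, Theorem 1.1, Prop. 2.5, Prop. 3.1, §6] -/
theorem thm11_monatomic_of_WZ {r : ℝ} (hr₁ : (1.10102 : ℝ) < r) (hr₂ : r < (1.13476 : ℝ))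
    {W Z : ℝ → ℝ} (hW : ContDiff ℝ ∞ W) (hZ : ContDiff ℝ ∞ Z)
    (hWeq : ∀ ξ : ℝ, (1 + (2 * W ξ + Z ξ) / 3) * deriv W ξ =
      -(r + 5 * W ξ / 6 + Z ξ / 3) * W ξ + Z ξ ^ 2 / 6)
    (hZeq : ∀ ξ : ℝ, (1 + (W ξ + 2 * Z ξ) / 3) * deriv Z ξ =
      -(r + W ξ / 3 + 5 * Z ξ / 6) * Z ξ + W ξ ^ 2 / 6)
    (hWZ : ∀ ξ : ℝ, Z ξ < W ξ)
    (hlimW : Tendsto W atTop (𝓝 0)) (hlimZ : Tendsto Z atTop (𝓝 0))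
    {g : ℝ → ℝ} (hg : AnalyticAt ℝ g 0) (hg0 : 0 < g 0) {ε : ℝ} (hε : 0 < ε)
    (horigin : ∀ ζ ∈ Ioo 0 ε, ζ * W (Real.log ζ) = g ζ ∧ -ζ * Z (Real.log ζ) = g (-ζ)) :
    BuckmasterCaolaboraGomezserrano2025_thm11_monatomic := by
  set 𝒲 : ℝ → ℝ := profileOfWZ W Z (g 0) with h𝒲
  have hposdef : ∀ ζ : ℝ, 0 < ζ → 𝒲 ζ = ζ * W (Real.log ζ) := fun ζ hζ => profileOfWZ_pos hζ
  have hnegdef : ∀ ζ : ℝ, ζ < 0 → 𝒲 ζ = ζ * Z (Real.log (-ζ)) := fun ζ hζ => profileOfWZ_neg hζ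
  have h0 : 𝒲 0 = g 0 := profileOfWZ_zero
  have hWd : Differentiable ℝ W := hW.differentiable (by simp)
  have hZd : Differentiable ℝ Z := hZ.differentiable (by simp)
  -- (a) analyticity at `ζ = 0`: `𝒲 = g` on `(-ε, ε)`
  have hnear : ∀ ζ ∈ Ioo (-ε) ε, 𝒲 ζ = g ζ := by
    intro ζ hζ
    rcases lt_trichotomy ζ 0 with hlt | rfl | hgt
    · have h := (horigin (-ζ) ⟨by linarith, by linarith [hζ.1]⟩).2
      rw [hnegdef ζ hlt]
      simpa using h
    · exact h0
    · rw [hposdef ζ hgt]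
      exact (horigin ζ ⟨hgt, hζ.2⟩).1
  have h_an : AnalyticAt ℝ 𝒲 0 := by
    have hev : 𝒲 =ᶠ[𝓝 0] g := by
      filter_upwards [Ioo_mem_nhds (show -ε < 0 by linarith) hε] with ζ hζ using hnear ζ hζ
    exact hg.congr hev.symm
  -- (b) smoothness away from `ζ = 0`
  have h_sm : ∀ ζ ≠ 0, ContDiffAt ℝ ∞ 𝒲 ζ := by
    intro ζ hζ
    rcases lt_or_gt_of_ne hζ with hlt | hgt
    · have hev : 𝒲 =ᶠ[𝓝 ζ] fun x => x * Z (Real.log (-x)) := by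
        filter_upwards [Iio_mem_nhds hlt] with x hx using hnegdef x hx
      refine ContDiffAt.congr_of_eventuallyEq ?_ hev
      have hlog : ContDiffAt ℝ ∞ (fun x => Real.log (-x)) ζ :=
        (Real.contDiffAt_log.mpr (by linarith : -ζ ≠ 0)).comp ζ contDiffAt_id.neg
      exact contDiffAt_id.mul (hZ.contDiffAt.comp ζ hlog)
    · have hev : 𝒲 =ᶠ[𝓝 ζ] fun x => x * W (Real.log x) := by
        filter_upwards [Ioi_mem_nhds hgt] with x hx using hposdef x hx
      refine ContDiffAt.congr_of_eventuallyEq ?_ hev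
      exact contDiffAt_id.mul (hW.contDiffAt.comp ζ (Real.contDiffAt_log.mpr hgt.ne'))
  -- (c) the profile equation (1.10) off the origin
  have h_ode := profile_ode_of_WZ (r := r) hWd hZd hWeq hZeq hposdef hnegdef
  -- (d) positivity `𝒲(ζ) + 𝒲(-ζ) > 0` for `ζ ≥ 0`
  have h_pos : ∀ ζ : ℝ, 0 ≤ ζ → 0 < 𝒲 ζ + 𝒲 (-ζ) := by
    intro ζ hζ
    rcases eq_or_lt_of_le hζ with h | h
    · subst h; rw [neg_zero, h0]; linarith
    · have h1 := hposdef ζ h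
      have h2 : 𝒲 (-ζ) = -ζ * Z (Real.log (- -ζ)) := hnegdef (-ζ) (by linarith)
      rw [profile_add_profile_neg h1 h2]
      exact mul_pos h (by linarith [hWZ (Real.log ζ)])
  -- (e) limits
  have h_limW := tendsto_profile_div hlimW hposdef
  have h_limZ := tendsto_profile_neg_div hlimZ hnegdef
  exact thm11_monatomic_of_profile hr₁ hr₂ h_an h_sm h_ode h_pos h_limW h_limZ

end BuckmasterCaolaboraGomezserrano2025

end Literature.Analysis.FluidPDE
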